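import Mathlib
import Literature.Computability.AlgebraicComplexity.LinSubst
import Literature.Computability.AlgebraicComplexity.OrbitClosure

/-!
# Border apolarity, crux `FixedWitnessObstructionQP` — CONE PURITY

Route `ValiantsHypothesis/BorderApolarity`, crux item `stmt-ValiantsHypothesis-5778`, line
`cone-purity-squeeze`, stub `stub_conePurity` (normal form N3): a subspace `J` of degree-`k` forms on
the `m²` variables, stable under `X y ↦ X y + c • X z` (`y` OWN — `ℓ = (0,0)` or in the `Y`-block —,
`z` UNUSED) and under the `z`-torus, of dimension `C(m²+k-1,k) - C(m,k)²`, has no nonzero `z`-free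
element once `C(m²+k-1,k) < C(m²-n²-2+k,k) + C(m,k)²`.  Abstract linear algebra on `MvPolynomial σ ℂ`
(`linSubst σ ℂ A : X i ↦ ∑ j, A j i • X j`): STEP B `coeff_lower_eq` (the `Z`-degree-`k` part of the
lowered form `D(X y ↦ X y + c_y S)`, `S = ∑_{z unused} X z`, is `D(c) • S^k`, with nonzero multinomial
coefficients), STEP C `torusSlices_mem` (torus stability makes `J` `Z`-multigraded), STEP A
`lower_mem` (the lowering is a composite of elementary substitutions), STEP D `choose_card_le_finrank`
(`dim J ≥ #Sym Z k = C(N+k-1,k)`), and `stub_conePurity` counts `N ≥ m² - n² - 1`.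
-/

open MvPolynomial Filter
open scoped BigOperators Matrix
open Literature.Computability.AlgebraicComplexity

namespace Summit.ValiantsHypothesis.ValiantsHypothesis.Theorems.BorderApolarityFixedWitnessObstructionQP

namespace ConePurity

/-- An exponent `e` agreeing with `γ` on the unused variables, where `γ` vanishes on the own ones
and `deg e = deg γ`, equals `γ`. [folklore] -/
theorem finsupp_eq_of_degree_eq {σ : Type*} [Fintype σ] (own : σ → Prop) {e γ : σ →₀ ℕ}
    (hZ : ∀ v, ¬ own v → e v = γ v) (hU : ∀ v, own v → γ v = 0)
    (hdeg : e.degree = γ.degree) : e = γ := by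
  have hsum : ∀ d : σ →₀ ℕ, d.degree = ∑ v, d v := fun d => by
    rw [Finsupp.degree_apply]
    exact Finset.sum_subset (Finset.subset_univ _) fun v _ hv => by simpa using hv
  have hle : ∀ v, γ v ≤ e v := fun v =>
    (em (own v)).elim (fun hv => (hU v hv).le.trans (Nat.zero_le _)) fun hv => (hZ v hv).ge
  ext v
  by_contra hne
  have hlt : ∑ u, γ u < ∑ u, e u :=
    Finset.sum_lt_sum (fun u _ => hle u) ⟨v, Finset.mem_univ v, lt_of_le_of_ne (hle v) (Ne.symm hne)⟩
  rw [← hsum, ← hsum] at hlt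
  omega

variable {σ : Type*}

/-- **STEP B.**  Modulo the ideal of the own variables the lowering substitution is
`X v ↦ c_v • S` (`v` own), under which a form `D` of degree `k` in the own variables becomes
`D(c) • S ^ k`; hence the coefficients of the lowered form at the exponents supported on the unused
variables are those of `D(c) • S ^ k`. [folklore] -/
theorem coeff_lower_eq (own : σ → Prop) [DecidablePred own] {k : ℕ} {D : MvPolynomial σ ℂ}
    (hhom : D.IsHomogeneous k) (hzfree : ∀ s ∈ D.support, ∀ v, ¬ own v → s v = 0)
    (c : σ → ℂ) (S : MvPolynomial σ ℂ) {γ : σ →₀ ℕ} (hγ : ∀ v, own v → γ v = 0) :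
    coeff γ (aeval (fun v => if own v then X v + C (c v) * S else X v) D) =
      eval c D * coeff γ (S ^ k) := by
  -- the substitution `X v ↦ c_v • S` (`v` own) maps `D` to `D(c) • S ^ k`
  have hB : aeval (fun v => if own v then C (c v) * S else X v) D = C (eval c D) * S ^ k := by
    rw [D.as_sum, map_sum, map_sum, map_sum, Finset.sum_mul]
    refine Finset.sum_congr rfl fun e he => ?_
    have hdeg : ∑ v ∈ e.support, e v = k := by
      rw [← Finsupp.degree_apply]
      by_contra h
      exact (mem_support_iff.mp he) (hhom.coeff_eq_zero h)
    have hprod : ∏ v ∈ e.support, (if own v then C (c v) * S else X v) ^ e v =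
        ∏ v ∈ e.support, (C (c v) * S) ^ e v := Finset.prod_congr rfl fun v hv => by
      rw [if_pos (not_not.1 fun h => (Finsupp.mem_support_iff.mp hv) (hzfree e he v h))]
    rw [aeval_monomial, eval_monomial, algebraMap_eq, Finsupp.prod, Finsupp.prod, hprod]
    simp_rw [mul_pow, ← map_pow]
    rw [Finset.prod_mul_distrib, ← map_prod, Finset.prod_pow_eq_pow_sum, hdeg, map_mul, mul_assoc]
  -- and it agrees with the lowering modulo the ideal `I` of the own variables
  set I : Ideal (MvPolynomial σ ℂ) := Ideal.span (MvPolynomial.X '' {v | own v}) with hI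
  have hmem : aeval (fun v => if own v then X v + C (c v) * S else X v) D -
      aeval (fun v => if own v then C (c v) * S else X v) D ∈ I := by
    rw [← Ideal.Quotient.eq, ← Ideal.Quotient.mkₐ_eq_mk ℂ]
    change ((Ideal.Quotient.mkₐ ℂ I).comp (aeval _)) D = ((Ideal.Quotient.mkₐ ℂ I).comp (aeval _)) D
    have hfun : (fun v => Ideal.Quotient.mkₐ ℂ I (if own v then X v + C (c v) * S else X v)) =
        fun v => Ideal.Quotient.mkₐ ℂ I (if own v then C (c v) * S else X v) := by
      funext v
      rw [Ideal.Quotient.mkₐ_eq_mk, Ideal.Quotient.eq]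
      by_cases hv : own v
      · rw [if_pos hv, if_pos hv, add_sub_cancel_right]; exact Ideal.subset_span ⟨v, hv, rfl⟩
      · rw [if_neg hv, if_neg hv, sub_self]; exact zero_mem _
    rw [comp_aeval, comp_aeval, hfun]
  have hzero := notMem_support_iff.1 fun hsupp =>
    (mem_ideal_span_X_image.1 hmem γ hsupp).elim fun i hi => hi.2 (hγ i hi.1)
  rwa [coeff_sub, sub_eq_zero, hB, coeff_C_mul] at hzero

variable [DecidableEq σ]

/-- Over `ℕ`, every monomial of degree `j` in the variables of `Zs` occurs in `(∑_{z ∈ Zs} X z) ^ j`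
with a positive coefficient (induction on `j`, peeling off one variable). [folklore] -/
theorem coeff_sum_X_pow_pos (Zs : Finset σ) :
    ∀ (j : ℕ) (γ : σ →₀ ℕ), (∀ v ∈ γ.support, v ∈ Zs) → γ.degree = j →
      0 < coeff γ ((∑ z ∈ Zs, X z : MvPolynomial σ ℕ) ^ j)
  | 0, γ, _, hdeg => by rw [Finsupp.degree_eq_zero_iff] at hdeg; subst hdeg; simp
  | j + 1, γ, hZ, hdeg => by
    obtain ⟨z₀, hz₀⟩ := (Finsupp.support_nonempty_iff (f := γ)).2 (by rintro rfl; simp at hdeg)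
    have hle : Finsupp.single z₀ 1 ≤ γ :=
      Finsupp.single_le_iff.2 (Nat.one_le_iff_ne_zero.2 (Finsupp.mem_support_iff.1 hz₀))
    have hdeg' : (γ - Finsupp.single z₀ 1).degree = j := by
      have h := congr_arg Finsupp.degree (tsub_add_cancel_of_le hle)
      rw [map_add, Finsupp.degree_single, hdeg] at h
      omega
    have ih := coeff_sum_X_pow_pos Zs j (γ - Finsupp.single z₀ 1)
      (fun v hv => hZ v (Finsupp.support_tsub hv)) hdeg'
    rw [pow_succ', Finset.sum_mul, coeff_sum]
    simp_rw [coeff_X_mul']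
    exact lt_of_lt_of_le (ih.trans_eq (if_pos hz₀).symm) (Finset.single_le_sum
      (f := fun x => if x ∈ γ.support then
        coeff (γ - Finsupp.single x 1) ((∑ z ∈ Zs, X z : MvPolynomial σ ℕ) ^ j) else 0)
      (fun _ _ => Nat.zero_le _) (hZ z₀ hz₀))

/-- **STEP B (coefficients).**  The coefficient of a monomial of degree `k` in the variables of `Zs`
in `(∑_{z ∈ Zs} X z) ^ k` is nonzero over `ℂ` (it is a multinomial coefficient). [folklore] -/
theorem coeff_sum_X_pow_ne_zero (Zs : Finset σ) (k : ℕ) (γ : σ →₀ ℕ)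
    (hZ : ∀ v ∈ γ.support, v ∈ Zs) (hdeg : γ.degree = k) :
    coeff γ ((∑ z ∈ Zs, X z : MvPolynomial σ ℂ) ^ k) ≠ 0 := by
  have hmap : ((∑ z ∈ Zs, X z : MvPolynomial σ ℂ) ^ k) =
      map (Nat.castRingHom ℂ) ((∑ z ∈ Zs, X z : MvPolynomial σ ℕ) ^ k) := by
    rw [map_pow, map_sum]
    simp_rw [map_X]
  rw [hmap, coeff_map, Nat.coe_castRingHom, Nat.cast_ne_zero]
  exact (coeff_sum_X_pow_pos Zs k γ hZ hdeg).ne'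

variable [Fintype σ]

/-- The `z`-torus element `X z ↦ d • X z` (other variables fixed) multiplies `a • x^e` by
`d ^ (e z)`. [folklore] -/
theorem linSubst_torus_monomial (z : σ) (d : ℂ) (e : σ →₀ ℕ) (a : ℂ) :
    linSubst σ ℂ (Matrix.diagonal (Function.update 1 z d)) (monomial e a) =
      d ^ (e z) • monomial e a := by
  have hX : ∀ i, linSubst σ ℂ (Matrix.diagonal (Function.update 1 z d))
      ((X i : MvPolynomial σ ℂ) ^ e i) = C (Function.update (1 : σ → ℂ) z d i ^ e i) * X i ^ e i := by
    intro i
    rw [map_pow, linSubst_X, Finset.sum_eq_single i (fun j _ hji => by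
      rw [Matrix.diagonal_apply_ne _ hji, zero_smul]) (fun hi => absurd (Finset.mem_univ i) hi),
      Matrix.diagonal_apply_eq, smul_eq_C_mul, mul_pow, ← map_pow]
  have h1 : monomial e a = C a * ∏ i, (X i : MvPolynomial σ ℂ) ^ e i := by
    rw [monomial_eq, Finsupp.prod_fintype _ _ fun i => pow_zero _]
  rw [h1, map_mul, linSubst_C, map_prod, smul_eq_C_mul]
  simp_rw [hX]
  rw [Finset.prod_mul_distrib, ← map_prod, Fintype.prod_eq_single z fun i hi => by
    rw [Function.update_of_ne hi, Pi.one_apply, one_pow], Function.update_self]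
  ring

/-- **STEP C, one variable.**  If `J` is stable under `X z ↦ d • X z` for all `d ≠ 0` and
`∑_{e ∈ S} a_e x^e ∈ J`, then each sub-sum over `{e | e z = j}` lies in `J`: for a functional `λ`
killing `J`, `d ↦ ∑_e λ(a_e x^e) d^{e z}` is a polynomial in `d` vanishing on the infinite set
`ℂ ∖ {0}`, so all its coefficients vanish. [folklore] -/
theorem torusSlice_mem (J : Submodule ℂ (MvPolynomial σ ℂ)) (z : σ)
    (htor : ∀ d : ℂ, d ≠ 0 → ∀ F ∈ J,
      linSubst σ ℂ (Matrix.diagonal (Function.update 1 z d)) F ∈ J)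
    (S : Finset (σ →₀ ℕ)) (a : (σ →₀ ℕ) → ℂ) (hG : ∑ e ∈ S, monomial e (a e) ∈ J) (j : ℕ) :
    ∑ e ∈ S with e z = j, monomial e (a e) ∈ J := by
  haveI : Infinite ℂ := Infinite.of_injective _ Nat.cast_injective
  rw [← Submodule.Quotient.mk_eq_zero]
  refine (Module.forall_dual_apply_eq_zero_iff ℂ _).1 fun φ => ?_
  set ψ : MvPolynomial σ ℂ →ₗ[ℂ] ℂ := φ ∘ₗ J.mkQ with hψ
  have hψJ : ∀ G ∈ J, ψ G = 0 := fun G hG' => show φ (Submodule.Quotient.mk G) = 0 by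
    rw [(Submodule.Quotient.mk_eq_zero J).2 hG', map_zero]
  change ψ (∑ e ∈ S with e z = j, monomial e (a e)) = 0
  -- the polynomial `d ↦ ψ (T_d G)` vanishes on `ℂ ∖ {0}`
  set p : Polynomial ℂ :=
    ∑ e ∈ S, Polynomial.C (ψ (monomial e (a e))) * Polynomial.X ^ (e z) with hp
  have heval : ∀ d : ℂ, p.eval d =
      ψ (linSubst σ ℂ (Matrix.diagonal (Function.update 1 z d)) (∑ e ∈ S, monomial e (a e))) := by
    intro d
    rw [map_sum, map_sum, hp, Polynomial.eval_finsetSum]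
    refine Finset.sum_congr rfl fun e _ => ?_
    rw [Polynomial.eval_mul, Polynomial.eval_C, Polynomial.eval_pow, Polynomial.eval_X,
      linSubst_torus_monomial, map_smul, smul_eq_mul, mul_comm]
  have hp0 : p = 0 := Polynomial.eq_zero_of_infinite_isRoot _ (Set.Infinite.mono
    (fun d hd => (heval d).trans (hψJ _ (htor d hd _ hG)))
    ((Set.finite_singleton (0 : ℂ)).infinite_compl))
  have hcoeff : p.coeff j = 0 := by rw [hp0, Polynomial.coeff_zero]
  simp only [hp, Polynomial.finsetSum_coeff, Polynomial.coeff_C_mul_X_pow] at hcoeff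
  rw [← Finset.sum_filter] at hcoeff
  rw [map_sum, Finset.filter_congr fun e _ => (eq_comm : e z = j ↔ j = e z)]
  exact hcoeff

/-- **STEP C.**  Iterating `torusSlice_mem` over a finite set `T` of torus directions: the sub-sum
of `∑_{e ∈ S} a_e x^e ∈ J` over the exponents with prescribed values `γ z`, `z ∈ T`, lies in `J`.
[folklore] -/
theorem torusSlices_mem (J : Submodule ℂ (MvPolynomial σ ℂ)) (T : Finset σ)
    (htor : ∀ z ∈ T, ∀ d : ℂ, d ≠ 0 → ∀ F ∈ J,
      linSubst σ ℂ (Matrix.diagonal (Function.update 1 z d)) F ∈ J)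
    (γ : σ → ℕ) (S : Finset (σ →₀ ℕ)) (a : (σ →₀ ℕ) → ℂ) (hG : ∑ e ∈ S, monomial e (a e) ∈ J) :
    ∑ e ∈ S with (∀ z ∈ T, e z = γ z), monomial e (a e) ∈ J := by
  induction T using Finset.induction_on with
  | empty => rwa [Finset.filter_true_of_mem fun e _ z hz => absurd hz (Finset.notMem_empty z)]
  | insert x T hx ih =>
    have h2 := torusSlice_mem J x (htor x (Finset.mem_insert_self x T)) _ a
      (ih fun z hz => htor z (Finset.mem_insert_of_mem hz)) (γ x)
    rw [Finset.filter_filter] at h2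
    rwa [Finset.filter_congr fun e (_ : e ∈ S) => show (∀ z ∈ insert x T, e z = γ z) ↔
      (∀ z ∈ T, e z = γ z) ∧ e x = γ x by simp only [Finset.mem_insert, forall_eq_or_imp, and_comm]]

/-- The elementary substitution `1 + a • single z y 1` sends `X y ↦ X y + a • X z` and fixes every
other variable. [folklore] -/
theorem linSubst_transvection_X (a : ℂ) (y z w : σ) :
    linSubst σ ℂ (1 + a • Matrix.single z y (1 : ℂ)) (X w) =
      X w + if w = y then a • X z else 0 := by
  have h : ∀ j, (1 + a • Matrix.single z y (1 : ℂ)) j w • (X j : MvPolynomial σ ℂ) =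
      (if j = w then X j else 0) + (if z = j ∧ y = w then a • X j else 0) := by
    intro j
    rw [Matrix.add_apply, Matrix.one_apply, Matrix.smul_apply, Matrix.single_apply, add_smul,
      smul_eq_mul]
    congr 1 <;> split_ifs <;> simp
  rw [linSubst_X]
  simp_rw [h]
  rw [Finset.sum_add_distrib, Finset.sum_ite_eq' Finset.univ w, if_pos (Finset.mem_univ w)]
  congr 1
  by_cases hyw : y = w
  · subst hyw
    simp only [and_true, if_true]
    rw [Finset.sum_ite_eq Finset.univ z, if_pos (Finset.mem_univ z)]
  · have hwy : ¬ w = y := fun h' => hyw h'.symm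
    simp only [hyw, and_false, if_false, Finset.sum_const_zero, hwy]

/-- **STEP A (lowering).**  If `J` is stable under every elementary substitution
`X y ↦ X y + c • X z` (`y` own, `z` unused), then composing these over all pairs `(y, z)` with
coefficient `c_y` shows that `J` is stable under `X y ↦ X y + c_y • ∑_{z unused} X z` (`y` own),
`X z ↦ X z` (`z` unused). [folklore] -/
theorem lower_mem (own : σ → Prop) [DecidablePred own] (J : Submodule ℂ (MvPolynomial σ ℂ))
    (hzif : ∀ y z, own y → ¬ own z → ∀ c : ℂ, ∀ D ∈ J,
      linSubst σ ℂ (1 + c • Matrix.single z y (1 : ℂ)) D ∈ J)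
    (c : σ → ℂ) {D : MvPolynomial σ ℂ} (hD : D ∈ J) :
    aeval (fun v => if own v then X v + C (c v) * ∑ z ∈ Finset.univ.filter (fun z => ¬ own z), X z
      else X v) D ∈ J := by
  -- the composite over the pairs `(y, z)`, `y` own, `z` unused
  suffices key : ∀ F ∈ J, aeval (fun v => X v + ∑ q ∈ (Finset.univ.filter own) ×ˢ
      (Finset.univ.filter fun z => ¬ own z), if q.1 = v then C (c v) * X q.2 else 0) F ∈ J by
    have hg : (fun v => if own v then X v + C (c v) * ∑ z ∈ Finset.univ.filter (fun z => ¬ own z),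
        X z else X v) = fun v => X v + ∑ q ∈ (Finset.univ.filter own) ×ˢ
          (Finset.univ.filter fun z => ¬ own z),
            if q.1 = v then C (c v) * X q.2 else (0 : MvPolynomial σ ℂ) := by
      funext v
      rw [← Finset.sum_filter, Finset.filter_product_left (fun y => y = v), Finset.filter_eq']
      by_cases hv : own v <;> simp [hv, Finset.mul_sum]
    rw [hg]
    exact key D hD
  refine Finset.induction_on' ((Finset.univ.filter own) ×ˢ (Finset.univ.filter fun z => ¬ own z))
    ?_ ?_
  · intro F hF
    rwa [show (fun v : σ => X v + ∑ q ∈ (∅ : Finset (σ × σ)),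
      (if q.1 = v then C (c v) * X q.2 else (0 : MvPolynomial σ ℂ))) = X from funext fun v => by simp,
      aeval_X_left_apply]
  · intro q P hq hP hqP ih F hF
    obtain ⟨hy, hz⟩ : own q.1 ∧ ¬ own q.2 := by simpa [Finset.mem_product] using hq
    suffices hcomp : aeval (fun v => X v + ∑ q' ∈ insert q P,
          if q'.1 = v then C (c v) * X q'.2 else (0 : MvPolynomial σ ℂ)) =
        (linSubst σ ℂ (1 + c q.1 • Matrix.single q.2 q.1 (1 : ℂ))).comp
          (aeval (fun v => X v + ∑ q' ∈ P,
            if q'.1 = v then C (c v) * X q'.2 else (0 : MvPolynomial σ ℂ))) by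
      rw [hcomp, AlgHom.comp_apply]
      exact hzif q.1 q.2 hy hz (c q.1) _ (ih F hF)
    refine MvPolynomial.algHom_ext fun v => ?_
    simp only [AlgHom.comp_apply, aeval_X]
    have hfix : ∀ q' ∈ P, linSubst σ ℂ (1 + c q.1 • Matrix.single q.2 q.1 (1 : ℂ))
        (if q'.1 = v then C (c v) * X q'.2 else 0) = if q'.1 = v then C (c v) * X q'.2 else 0 := by
      intro q' hq'
      have hz' : ¬ own q'.2 := by simpa [Finset.mem_product] using (Finset.mem_product.1 (hP hq')).2
      split_ifs
      · rw [map_mul, linSubst_C, linSubst_transvection_X,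
          if_neg fun h : q'.2 = q.1 => hz' (h ▸ hy), add_zero]
      · exact map_zero _
    rw [map_add, map_sum, linSubst_transvection_X, Finset.sum_insert hqP,
      Finset.sum_congr rfl hfix]
    by_cases h : v = q.1
    · subst h; simp [smul_eq_C_mul]; ring
    · rw [if_neg (fun h' => h h'.symm), if_neg h]; ring

/-- **Cone purity, abstract form (STEP D).**  If a subspace `J` of degree-`k` forms, stable under
the substitutions `X y ↦ X y + c • X z` (`y` own, `z` unused) and under the `z`-torus, contains a
nonzero form `D` in the own variables only, then it contains every monomial of degree `k` in the
unused variables (lower `D` to `D' ∈ J`, STEP A; its part of `Z`-degree `k` is `D(c) • S^k`, STEP B,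
with `D(c) ≠ 0` as `ℂ` is infinite; extract the `Z`-multidegree components, STEP C), whence
`dim J ≥ #Sym Z k = C(N + k - 1, k)`, `N = #{unused}`. [folklore] -/
theorem choose_card_le_finrank (own : σ → Prop) [DecidablePred own] (k : ℕ)
    (J : Submodule ℂ (MvPolynomial σ ℂ)) (hhom : ∀ D ∈ J, D.IsHomogeneous k)
    (hzif : ∀ y z, own y → ¬ own z → ∀ c : ℂ, ∀ D ∈ J,
      linSubst σ ℂ (1 + c • Matrix.single z y (1 : ℂ)) D ∈ J)
    (htor : ∀ z, ¬ own z → ∀ d : ℂ, d ≠ 0 → ∀ D ∈ J,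
      linSubst σ ℂ (Matrix.diagonal (Function.update 1 z d)) D ∈ J)
    {D : MvPolynomial σ ℂ} (hD : D ∈ J) (hzfree : ∀ s ∈ D.support, ∀ v, ¬ own v → s v = 0)
    (hD0 : D ≠ 0) : 1 ≤ Module.finrank ℂ J ∧
      (Fintype.card {v // ¬ own v} + k - 1).choose k ≤ Module.finrank ℂ J := by
  haveI : Infinite ℂ := Infinite.of_injective _ Nat.cast_injective
  haveI : Module.Finite ℂ (homogeneousSubmodule σ ℂ k) :=
    Module.Finite.iff_fg.2 (homogeneousSubmodule_fg σ ℂ k)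
  haveI : Module.Finite ℂ J :=
    Submodule.finiteDimensional_of_le fun E hE => (mem_homogeneousSubmodule k E).2 (hhom E hE)
  refine ⟨Submodule.one_le_finrank_iff.2 fun h => hD0 ((Submodule.mem_bot ℂ).1 (h ▸ hD)), ?_⟩
  -- a point `c` where `D` does not vanish, and the lowered form `D'`
  obtain ⟨c, hc⟩ : ∃ c : σ → ℂ, eval c D ≠ 0 :=
    not_forall_not.1 fun h => hD0 (MvPolynomial.funext fun x => by rw [not_not.1 (h x), map_zero])
  set Zs : Finset σ := Finset.univ.filter fun z => ¬ own z with hZs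
  have hmemZs : ∀ {z : σ}, z ∈ Zs ↔ ¬ own z := fun {z} => by simp [hZs]
  set D' : MvPolynomial σ ℂ :=
    aeval (fun v => if own v then X v + C (c v) * ∑ z ∈ Zs, X z else X v) D with hD'
  have hD'J : D' ∈ J := lower_mem own J hzif c hD
  -- every monomial of degree `k` in the unused variables lies in `J`
  have hmono : ∀ γ : σ →₀ ℕ, (∀ v, own v → γ v = 0) → γ.degree = k →
      monomial γ (1 : ℂ) ∈ J := by
    intro γ hγU hγdeg
    have hne : coeff γ D' ≠ 0 := by
      rw [hD', coeff_lower_eq own (hhom D hD) hzfree c _ hγU]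
      exact mul_ne_zero hc (coeff_sum_X_pow_ne_zero Zs k γ
        (fun v hv => hmemZs.2 fun h => (Finsupp.mem_support_iff.1 hv) (hγU v h)) hγdeg)
    have hsum : ∑ e ∈ D'.support, monomial e (coeff e D') ∈ J := by rwa [← D'.as_sum]
    have hcomp := torusSlices_mem J Zs (fun z hz => htor z (hmemZs.1 hz)) γ D'.support
      (fun e => coeff e D') hsum
    rw [Finset.sum_eq_single_of_mem γ] at hcomp
    · have h := J.smul_mem (coeff γ D')⁻¹ hcomp
      rwa [smul_monomial, smul_eq_mul, inv_mul_cancel₀ hne] at h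
    · exact Finset.mem_filter.2 ⟨mem_support_iff.2 hne, fun z _ => rfl⟩
    · intro e he hne'
      obtain ⟨he1, he2⟩ := Finset.mem_filter.1 he
      refine absurd (finsupp_eq_of_degree_eq own (fun v hv => he2 v (hmemZs.2 hv)) hγU ?_) hne'
      rw [hγdeg]
      by_contra h
      exact (mem_support_iff.1 he1) ((hhom D' hD'J).coeff_eq_zero h)
  -- exponents of degree `k` in the unused variables, indexed by `Sym {v // ¬ own v} k`
  have hexU : ∀ (s : Sym {v // ¬ own v} k) (v : σ), own v →
      Multiset.toFinsupp ((s : Multiset {v // ¬ own v}).map Subtype.val) v = 0 := fun s v hv => by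
    rw [Multiset.toFinsupp_apply, Multiset.count_eq_zero, Multiset.mem_map]
    exact fun ⟨w, _, hw⟩ => w.2 (hw ▸ hv)
  have hdegt : ∀ t : Multiset σ, (Multiset.toFinsupp t).degree = Multiset.card t := fun t => by
    rw [← Multiset.toFinsupp_sum_eq t, Finsupp.degree_apply, Finsupp.sum]
    rfl
  have hexdeg : ∀ s : Sym {v // ¬ own v} k,
      (Multiset.toFinsupp ((s : Multiset {v // ¬ own v}).map Subtype.val)).degree = k := fun s => by
    rw [hdegt, Multiset.card_map, Sym.card_coe]
  have hex_inj : Function.Injective fun s : Sym {v // ¬ own v} k =>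
      Multiset.toFinsupp ((s : Multiset {v // ¬ own v}).map Subtype.val) := fun s t hst =>
    Sym.coe_injective (Multiset.map_injective Subtype.val_injective
      (Multiset.toFinsupp.injective hst))
  -- the corresponding monomials are linearly independent elements of `J`
  have hli : LinearIndependent ℂ fun s : Sym {v // ¬ own v} k =>
      (⟨monomial (Multiset.toFinsupp ((s : Multiset {v // ¬ own v}).map Subtype.val)) 1,
        hmono _ (hexU s) (hexdeg s)⟩ : J) :=
    LinearIndependent.of_comp J.subtype ((basisMonomials σ ℂ).linearIndependent.comp
      (fun s : Sym {v // ¬ own v} k =>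
        Multiset.toFinsupp ((s : Multiset {v // ¬ own v}).map Subtype.val)) hex_inj)
  exact (Sym.card_sym_eq_choose (α := {v // ¬ own v}) k) ▸ hli.fintype_card_le_finrank

end ConePurity

open ConePurity in
/-- **CONE PURITY (normal form N3 of the `cone-purity-squeeze` skeleton; the card's first lemma).**
For a subspace `J` of degree-`k` operators on the `m²` variables which is stable under the elementary
substitutions `∂_y ↦ ∂_y + c·∂_z` (`y` an own variable `ℓ = X₀₀` or `Y_ij`, `i,j ≥ m-n`; `z` an unused
variable) and under the `z`-torus, and whose dimension is `dim Ann_k(det_m) = C(m²+k-1,k) - C(m,k)²`,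
the budget inequality `C(m²+k-1,k) < C(m²-n²-2+k,k) + C(m,k)²` forbids any nonzero `z`-FREE element:
there are `N ≥ m² - n² - 1` unused variables, so a nonzero `z`-free `D ∈ J` gives `dim J ≥ C(N+k-1,k)`
(`choose_card_le_finrank`) and `dim J ≥ 1`, contradicting the budget. [folklore] -/
theorem stub_conePurity (n m k : ℕ) [NeZero m]
    (J : Submodule ℂ (MvPolynomial (Fin m × Fin m) ℂ))
    (hhom : ∀ D ∈ J, D.IsHomogeneous k)
    (hzif : ∀ y z : Fin m × Fin m,
      ((m - n ≤ (y.1 : ℕ) ∧ m - n ≤ (y.2 : ℕ)) ∨ y = (0, 0)) →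
      ¬ ((m - n ≤ (z.1 : ℕ) ∧ m - n ≤ (z.2 : ℕ)) ∨ z = (0, 0)) →
      ∀ c : ℂ, ∀ D ∈ J, linSubst (Fin m × Fin m) ℂ (1 + c • Matrix.single z y (1 : ℂ)) D ∈ J)
    (htor : ∀ z : Fin m × Fin m,
      ¬ ((m - n ≤ (z.1 : ℕ) ∧ m - n ≤ (z.2 : ℕ)) ∨ z = (0, 0)) →
      ∀ d : ℂ, d ≠ 0 → ∀ D ∈ J, linSubst (Fin m × Fin m) ℂ (Matrix.diagonal (Function.update 1 z d)) D ∈ J)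
    (hdim : Module.finrank ℂ J = Nat.choose (m * m + k - 1) k - (Nat.choose m k) ^ 2)
    (hbudget : Nat.choose (m * m + k - 1) k < Nat.choose (m * m - n * n - 2 + k) k + (Nat.choose m k) ^ 2) :
    ∀ D ∈ J, (∀ s ∈ D.support, ∀ v : Fin m × Fin m,
      ¬ ((m - n ≤ (v.1 : ℕ) ∧ m - n ≤ (v.2 : ℕ)) ∨ v = (0, 0)) → s v = 0) → D = 0 := by
  classical
  intro D hD hzfree
  by_contra hD0
  obtain ⟨h1, hbound⟩ := choose_card_le_finrank
    (fun v : Fin m × Fin m => (m - n ≤ (v.1 : ℕ) ∧ m - n ≤ (v.2 : ℕ)) ∨ v = (0, 0))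
    k J hhom hzif htor hD hzfree hD0
  -- there are at most `n² + 1` own variables, hence at least `m² - n² - 1` unused ones
  have hB : Fintype.card {i : Fin m // m - n ≤ (i : ℕ)} ≤ n := (le_or_gt n m).elim
    (fun h => (card_blockIdx h).le)
    fun h => (Fintype.card_subtype_le _).trans (by rw [Fintype.card_fin]; omega)
  have hown : Fintype.card {v : Fin m × Fin m //
      (m - n ≤ (v.1 : ℕ) ∧ m - n ≤ (v.2 : ℕ)) ∨ v = (0, 0)} ≤ n * n + 1 := by
    refine (Fintype.card_subtype_or _ _).trans ?_
    rw [Fintype.card_congr (Equiv.subtypeProdEquivProd (p := fun i : Fin m => m - n ≤ (i : ℕ))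
      (q := fun i : Fin m => m - n ≤ (i : ℕ))), Fintype.card_prod, Fintype.card_subtype_eq]
    exact Nat.add_le_add_right (Nat.mul_le_mul hB hB) 1
  have hZ : m * m - (n * n + 1) + k - 1 ≤ Fintype.card {v : Fin m × Fin m //
      ¬ ((m - n ≤ (v.1 : ℕ) ∧ m - n ≤ (v.2 : ℕ)) ∨ v = (0, 0))} + k - 1 := by
    rw [Fintype.card_subtype_compl, Fintype.card_prod, Fintype.card_fin]
    omega
  have hle := (Nat.choose_le_choose k hZ).trans hbound
  rcases Nat.eq_zero_or_pos (m * m - (n * n + 1)) with h0 | hpos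
  · rw [show m * m - n * n - 2 + k = k by omega, Nat.choose_self] at hbudget
    omega
  · rw [show m * m - (n * n + 1) + k - 1 = m * m - n * n - 2 + k by omega] at hle
    omega

end Summit.ValiantsHypothesis.ValiantsHypothesis.Theorems.BorderApolarityFixedWitnessObstructionQP
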